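import Summits.ResolutionOfSingularities.ResolutionOfSingularities.Theorems.WeightedInvariantIota3NonreachKTransport
import HarnessLib

/-!
# (NONREACH-K) HOLDS: the curve regime of (D-b³) for `J₃ᵗ` of record is CLOSED — gap list hD + (D-b³-point) for `stub_keyRungGrHomLE_three`
# (door `HypersurfaceCentreConstruction`, stmt-ResolutionOfSingularities-19897)

Helper for `stub_keyRungGrHomLE_three` (def-free, `--supports 19897`).  Hand -10's sharpest gap list of record
`keyRungGrHomLE_three_of_tieDescent_point_nonreachK` (…KeyRungThreeOfDropCurveNonreachK; SIGMA-ISO.md rev 3) had three hypotheses: hD (typing),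
(D-b³-point) (the crux) and (NONREACH-K) «at the pinned regular local threefold `B_𝔫` of a fractional tied curve centre, the saturated transform
reaches the slope `1 + (r mod q)/q` along NO translate `W − c'·t⁻¹`».  This file DISCHARGES (NONREACH-K):

* **`Iota3.nonreachK_holds`** — (NONREACH-K) in the door's binders, for every `p`.  Proof = the four tools of this hand: the AQS-face unit
  expansion of `f` in `S` (`exists_faceExpansion_three` ⟸ `mem_weightedMonomialIdeal_of_curve_lexMax`), the `τ = 0` witness
  (`not_mem_tie_of_curve_lexMax` at `λ = 0`, read on the expansion by `exists_weight_lt_of_not_mem`), the transport to `B_𝔫`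
  (`transport_faceExpansion`: `x = T·X`, `y = T^b·W`, exponents `(j,i,k) ↦ (j + bi − bν, k, i)`, FACE `rν ≤ qj + ri` ↦ `ρν ≤ qe₀ + ρe₂`, WITNESS
  `qj + (r+1)i + k < (r+1)ν` ↦ `qe₀ + e₁ + (ρ+1)e₂ < (ρ+1)ν`, `r = qb + ρ`), and the uniform-in-`c'` core
  `not_mem_ratContactFiltration_translate_of_expansion` (line-top witness + isolated-coefficient lemma).
* **`keyRungGrHomLE_three_of_tieDescent_point`** (NEW GAP LIST OF RECORD) and **`keyRungGrHomLE_three_of_c11_point`** —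
  `KeyRungGrHomLE 3 p ⟸` hD (resp. (c11)≤3) + **(D-b³-point)** ONLY: the whole CURVE regime of (D-b³) (hands -8 … -11: tie-free, integer slope,
  fractional tie at `λ ≠ 0`, fractional tie at `λ = 0`) is now kernel-proved; what remains of `stub_keyRungGrHomLE_three` besides the typing
  item hD / (c11)≤3 is the POINT regime (D-b³-point) — the `ι₃ᵗ`-drop at the `t`-homogeneous singular successors of a CLOSED-POINT centre
  (`P = 𝔪_S`), i.e. the crux proper.

[OURS · L1 W4.3 · audit glue + kernel proof; AI work, weaker than expert review; nothing here is a statement of the manuscript under review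
(Hironaka 2017, [claim: Hironaka2017, status: under-review]).]

## References

* H. Hironaka, *Characteristic polyhedra of singularities*, J. Math. Kyoto Univ. 7 (1967), §3. [Hironaka1967]
* D. Abramovich, M. H. Quek, B. Schober, arXiv:2507.01232 (2025), Thm 1.3 (3), Thm 3.5. [AbramovichQuekSchober2025]
* res-L1-w43-idea-2, Sketch-R9 §5 (OURS); hand -10, SIGMA-ISO.md rev 3; hand -11 (this), NONREACH-K.md (crux directory; OURS).
-/

noncomputable section

set_option linter.dupNamespace false -- mandated namespace of this single-conjunct summit

open IsLocalRing Literature.AlgebraicGeometry.Resolution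
open Summit.ResolutionOfSingularities.ResolutionOfSingularities.Theorems
open Summit.ResolutionOfSingularities.ResolutionOfSingularities.Theorems.ContactCylinder
open Summit.ResolutionOfSingularities.ResolutionOfSingularities.Cruxes.HypersurfaceCentreConstruction.LocalEngine.Iota3.RatContact

namespace Summit.ResolutionOfSingularities.ResolutionOfSingularities.Cruxes.HypersurfaceCentreConstruction.LocalEngine

namespace Iota3

/-- Bookkeeping of the transport of FACE and WITNESS (`r = q·b + ρ`, `γ₀ + bγ₁ = bν + s`): `rν ≤ qγ₀ + rγ₁ ⟹ ρν ≤ qs + ργ₁` and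
`qγ₀ + (r+1)γ₁ + γ₂ < (r+1)ν ⟹ qs + γ₂ + (ρ+1)γ₁ < (ρ+1)ν`. [folklore] -/
theorem face_witness_transport {q b ρ r ν γ₀ γ₁ γ₂ s : ℕ} (hr : q * b + ρ = r) (hs : γ₀ + b * γ₁ = b * ν + s) :
    (r * ν ≤ q * γ₀ + r * γ₁ → ρ * ν ≤ q * s + ρ * γ₁) ∧
      (q * γ₀ + (r + 1) * γ₁ + γ₂ < (r + 1) * ν → q * s + γ₂ + (ρ + 1) * γ₁ < (ρ + 1) * ν) := by
  subst hr
  have hs' : q * γ₀ + q * (b * γ₁) = q * (b * ν) + q * s := by rw [← mul_add, hs, mul_add]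
  have e1 : (q * b + ρ) * ν = q * (b * ν) + ρ * ν := by ring
  have e2 : q * γ₀ + (q * b + ρ) * γ₁ = (q * γ₀ + q * (b * γ₁)) + ρ * γ₁ := by ring
  have e3 : (q * b + ρ + 1) * ν = q * (b * ν) + (ρ + 1) * ν := by ring
  have e4 : q * γ₀ + (q * b + ρ + 1) * γ₁ + γ₂ = (q * γ₀ + q * (b * γ₁)) + (ρ + 1) * γ₁ + γ₂ := by ring
  constructor
  · intro h; rw [e1, e2, hs'] at h; omega
  · intro h; rw [e3, e4, hs'] at h; omega

/-- **(NONREACH-K) HOLDS** (module docstring): at the pinned regular local threefold of a fractional tied curve centre the saturated transform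
reaches the slope `1 + (r mod q)/q` along no translate `W − c'·t⁻¹`. [OURS · L1 W4.3] [cite: Hironaka1967, §3] -/
theorem nonreachK_holds (p : ℕ) :
    ∀ (k₀ : Type) [Field k₀] [CharP k₀ p] [PerfectField k₀]
      (S : Type) [CommRing S] [Algebra k₀ S] [Algebra.EssFiniteType k₀ S] [IsRegularLocalRing S]
      (f : S), ringKrullDim S = 3 → f ≠ 0 → f ∈ (maximalIdeal S) ^ 2 →
      ∀ (P : Ideal S) [P.IsPrime], IsRegularLocalRing (S ⧸ P) → f ∈ P →
        topStratum iotaOrdEpsTau S f = {𝔮 | P ≤ 𝔮.asIdeal} → ¬ ringKrullDim (Localization.AtPrime P) ≤ 1 →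
        P ≠ maximalIdeal S →
        ∀ (x y z : S) (q r ν : ℕ) (_ : (Ideal.span ({x, y} : Set S)).IsPrime), Ideal.span {x, y, z} = maximalIdeal S →
          P = Ideal.span {x, y} → 2 ≤ q → q ≤ r → 1 ≤ ν → f ∈ maximalIdeal S ^ ν → f ∉ maximalIdeal S ^ (ν + 1) →
          IsLexMaxWeightedCentreGerm (Localization.AtPrime (Ideal.span ({x, y} : Set S)))
            (Ideal.span {algebraMap S (Localization.AtPrime (Ideal.span ({x, y} : Set S))) f})
            ![algebraMap S (Localization.AtPrime (Ideal.span ({x, y} : Set S))) y,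
              algebraMap S (Localization.AtPrime (Ideal.span ({x, y} : Set S))) x] ![r, q] (r * ν) →
          1 ≤ r / q → f ∈ weightedMonomialIdeal ![y, x] ![r / q, 1] (r / q * ν) →
          (∀ m : ℕ, jFlatT S f m = weightedMonomialIdeal ![y, x] ![r / q, 1] m) →
        ∀ (n : ℕ) (u : Fin n → S) (w : Fin n → ℕ),
          Ideal.span (Set.range u) = maximalIdeal S → (maximalIdeal S).spanFinrank = n → (∃ i, 0 < w i) →
          Ideal.span {x | ∃ i, 0 < w i ∧ x = u i} = P →
          (∀ m : ℕ, weightedMonomialIdeal u w m = jFlatT S f m) →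
          ∀ (𝔫 : Ideal (cobordantAlgebra' u w)) [𝔫.IsPrime], IsTHomogeneous u w 𝔫 → cobordantT' u w ∈ 𝔫 →
            (maximalIdeal S).map (algebraMap S (cobordantAlgebra' u w)) ≤ 𝔫 →
            ¬ extReesAlgebra.vertexIdeal (weightedMonomialIdeal u w) ≤ 𝔫 →
            ∀ (a : ℕ) (g : cobordantAlgebra' u w), algebraMap S (cobordantAlgebra' u w) f = cobordantT' u w ^ a * g →
              ¬ cobordantT' u w ∣ g →
              algebraMap (cobordantAlgebra' u w) (Localization.AtPrime 𝔫) g ∈ maximalIdeal (Localization.AtPrime 𝔫) ^ 2 →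
              f ∈ weightedMonomialIdeal ![x, y, z] ![1, r / q + 1, 1] ((r / q + 1) * ν) →
              ∀ W : cobordantAlgebra' u w, algebraMap S (cobordantAlgebra' u w) y = cobordantT' u w ^ (r / q) * W →
                𝔫 = Ideal.span {cobordantT' u w, algebraMap S (cobordantAlgebra' u w) z, W} →
                IsRegularLocalRing (Localization.AtPrime 𝔫) → ringKrullDim (Localization.AtPrime 𝔫) = (3 : ℕ) →
                Ideal.span {algebraMap _ (Localization.AtPrime 𝔫) (cobordantT' u w),
                  algebraMap _ (Localization.AtPrime 𝔫) (algebraMap S (cobordantAlgebra' u w) z),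
                  algebraMap _ (Localization.AtPrime 𝔫) W} = maximalIdeal (Localization.AtPrime 𝔫) →
              ∀ c' : Localization.AtPrime 𝔫,
                algebraMap (cobordantAlgebra' u w) (Localization.AtPrime 𝔫) g ∉
                  ratContactFiltration (algebraMap _ (Localization.AtPrime 𝔫) W - c' * algebraMap _ (Localization.AtPrime 𝔫) (cobordantT' u w))
                    (q + r % q) q ((q + r % q) * ν) := by
  intro k₀ _ _ _ S _ _ _ _ f hd hf0 hf2 P _ hreg hfP hE hP1 hPm x y z q r ν hPxy hxyz hPeq hq2 hqr hν1 hfν hfν1 hlex hb1 hadm hJ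
    n u w h1 h2 h3 h4 h5 𝔫 _ hhom hT hM hV a g hfg hTg hg2 hft0 W hW h𝔫 hR1 hR2 hR3 c'
  classical
  haveI := hR1
  haveI := hPxy
  subst hPeq
  -- numerology
  have hq : 0 < q := by omega
  have hdiv : q * (r / q) + r % q = r := Nat.div_add_mod r q
  have hρq : r % q < q := Nat.mod_lt r hq
  have hqb : q * (r / q) ≤ r := by omega
  -- frames and dimensions
  have hd3 : ringKrullDim S = (3 : ℕ) := by rw [hd]; rfl
  have hrk : (maximalIdeal S).spanFinrank = 3 := by
    have h := IsRegularLocalRing.spanFinrank_maximalIdeal (R := S)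
    rw [hd3] at h
    exact_mod_cast h
  have hyxz : Ideal.span (Set.range ![y, x, z]) = maximalIdeal S := by rw [range_three, Set.insert_comm]; exact hxyz
  have hxyz' : Ideal.span (Set.range ![x, y, z]) = maximalIdeal S := by rw [range_three]; exact hxyz
  have hq1 : ringKrullDim (S ⧸ Ideal.span ({x, y} : Set S)) = 1 := ringKrullDim_quotient_eq_one_of_curveCentre hd _ hreg hP1 hPm
  have hf : f ∈ maximalIdeal S := Ideal.pow_le_self two_ne_zero hf2
  -- the AQS face in `S` and the face-supported unit expansion of `f`
  have hfaceMem : f ∈ weightedMonomialIdeal ![y, x] ![r, q] (r * ν) :=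
    mem_weightedMonomialIdeal_of_curve_lexMax hd (Ideal.span ({x, y} : Set S)) rfl hxyz hν1 hlex
  set M : ℕ := (q + r % q) * ν + r / q * ν + (r + 1) * ν with hMdef
  obtain ⟨Δ, aS, hunitS, hfaceS, hrS⟩ := LocalGameEFTNewton.exists_faceExpansion_three hxyz hfaceMem M
  -- the `τ = 0` witness on the expansion
  have hwitS : f ∉ weightedMonomialIdeal ![x, y, z] ![q, r + 1, 1] ((r + 1) * ν) := by
    have h := not_mem_tie_of_curve_lexMax hd hf0 hf (Ideal.span ({x, y} : Set S)) hE hP1 hPm hq1 rfl hxyz hfν hfν1 hlex 0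
    rwa [zero_mul, sub_zero] at h
  have hw3 : ∀ i, 0 < (![q, r + 1, 1] : Fin 3 → ℕ) i := by intro i; fin_cases i <;> simp [hq]
  obtain ⟨γw, hγw, hγwlt⟩ := LocalGameEFTNewton.exists_weight_lt_of_not_mem ![x, y, z] hxyz' ![q, r + 1, 1] hw3 hrS
    (show (r + 1) * ν ≤ M by rw [hMdef]; omega) hwitS
  simp only [Fin.sum_univ_three, Matrix.cons_val_zero, Matrix.cons_val_one, Matrix.cons_val_two, Matrix.tail_cons, Matrix.head_cons,
    one_mul] at hγwlt
  -- transport to `B_𝔫`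
  have hpres : ∀ m : ℕ, weightedMonomialIdeal u w m = weightedMonomialIdeal ![y, x] ![r / q, 1] m := fun m => by rw [h5 m, hJ m]
  have hW𝔫 : W ∈ 𝔫 := by rw [h𝔫]; exact Ideal.subset_span (by simp)
  obtain ⟨a', hunit', hr'⟩ := transport_faceExpansion hyxz hrk hb1 hq hqb hfν1 hadm hunitS hfaceS hrS u w hpres 𝔫 hM hV hfg hTg W hW
    hW𝔫 hR1 hR2 hR3
  -- the bookkeeping of FACE / WITNESS along `(j,i,k) ↦ (j + bi − bν, k, i)`
  have hcoord : ∀ γ : Fin 3 → ℕ, (![γ 0 + r / q * γ 1 - r / q * ν, γ 2, γ 1] : Fin 3 → ℕ) 0 = γ 0 + r / q * γ 1 - r / q * ν ∧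
      (![γ 0 + r / q * γ 1 - r / q * ν, γ 2, γ 1] : Fin 3 → ℕ) 1 = γ 2 ∧
      (![γ 0 + r / q * γ 1 - r / q * ν, γ 2, γ 1] : Fin 3 → ℕ) 2 = γ 1 := fun γ => by simp
  have hface' : ∀ α ∈ Δ.image (fun γ : Fin 3 → ℕ => (![γ 0 + r / q * γ 1 - r / q * ν, γ 2, γ 1] : Fin 3 → ℕ)),
      r % q * ν ≤ q * α 0 + r % q * α 2 := by
    intro α hα
    obtain ⟨γ, hγ, rfl⟩ := Finset.mem_image.mp hα
    obtain ⟨h0, -, h2⟩ := hcoord γ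
    rw [h0, h2]
    have hle := le_of_face hq hqb (hfaceS γ hγ)
    obtain ⟨s, hs⟩ : ∃ s, γ 0 + r / q * γ 1 = r / q * ν + s := ⟨γ 0 + r / q * γ 1 - r / q * ν, by omega⟩
    rw [show γ 0 + r / q * γ 1 - r / q * ν = s by omega]
    exact (face_witness_transport (γ₂ := γ 2) hdiv hs).1 (hfaceS γ hγ)
  have hwit' : ∃ α ∈ Δ.image (fun γ : Fin 3 → ℕ => (![γ 0 + r / q * γ 1 - r / q * ν, γ 2, γ 1] : Fin 3 → ℕ)),
      q * α 0 + α 1 + (r % q + 1) * α 2 < (r % q + 1) * ν := by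
    refine ⟨_, Finset.mem_image_of_mem _ hγw, ?_⟩
    obtain ⟨h0, h1, h2⟩ := hcoord γw
    rw [h0, h1, h2]
    have hle := le_of_face hq hqb (hfaceS γw hγw)
    obtain ⟨s, hs⟩ : ∃ s, γw 0 + r / q * γw 1 = r / q * ν + s := ⟨γw 0 + r / q * γw 1 - r / q * ν, by omega⟩
    rw [show γw 0 + r / q * γw 1 - r / q * ν = s by omega]
    exact (face_witness_transport hdiv hs).2 hγwlt
  -- the uniform-in-`c'` core at the pinned successor
  exact not_mem_ratContactFiltration_translate_of_expansion hR2 hR3 hρq (show (q + r % q) * ν ≤ M - r / q * ν by rw [hMdef]; omega)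
    hunit' hr' hface' hwit' c'

/-- **NEW GAP LIST OF RECORD for `stub_keyRungGrHomLE_three` — hD + (D-b³-point)** (module docstring): the CURVE regime of (D-b³) for `J₃ᵗ` of
record is closed in the kernel; what remains is the typing item hD and the crux (D-b³-point). [OURS · L1 W4.3 · audit glue] -/
theorem keyRungGrHomLE_three_of_tieDescent_point (p : ℕ)
    (hD : ∀ (T T' : Type) [CommRing T] [IsRegularLocalRing T] [CommRing T'] [IsRegularLocalRing T'] [Algebra T T']
      [IsLocalHom (algebraMap T T')] [Algebra.FormallySmooth T T'] [Algebra.EssFiniteType T T'] (g : T),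
      ringKrullDim T' ≤ 3 → IsTiePosition T' (algebraMap T T' g) → IsTiePosition T g)
    (hPOINT : ∀ (k₀ : Type) [Field k₀] [CharP k₀ p] [PerfectField k₀]
      (S : Type) [CommRing S] [Algebra k₀ S] [Algebra.EssFiniteType k₀ S] [IsRegularLocalRing S]
      (f : S), ringKrullDim S = 3 → f ≠ 0 → f ∈ (maximalIdeal S) ^ 2 →
      ∀ (P : Ideal S) [P.IsPrime], IsRegularLocalRing (S ⧸ P) → f ∈ P →
        topStratum iotaOrdEpsTau S f = {𝔮 | P ≤ 𝔮.asIdeal} → ¬ ringKrullDim (Localization.AtPrime P) ≤ 1 →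
        P = maximalIdeal S →
        ∀ (n : ℕ) (u : Fin n → S) (w : Fin n → ℕ),
          Ideal.span (Set.range u) = maximalIdeal S → (maximalIdeal S).spanFinrank = n → (∃ i, 0 < w i) →
          Ideal.span {x | ∃ i, 0 < w i ∧ x = u i} = P →
          (∀ m : ℕ, weightedMonomialIdeal u w m = jFlatT S f m) →
          ∀ (𝔫 : Ideal (cobordantAlgebra' u w)) [𝔫.IsPrime], IsTHomogeneous u w 𝔫 → cobordantT' u w ∈ 𝔫 →
            (maximalIdeal S).map (algebraMap S (cobordantAlgebra' u w)) ≤ 𝔫 →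
            ¬ extReesAlgebra.vertexIdeal (weightedMonomialIdeal u w) ≤ 𝔫 →
            ∀ (a : ℕ) (g : cobordantAlgebra' u w), algebraMap S (cobordantAlgebra' u w) f = cobordantT' u w ^ a * g →
              ¬ cobordantT' u w ∣ g →
              algebraMap (cobordantAlgebra' u w) (Localization.AtPrime 𝔫) g ∈ maximalIdeal (Localization.AtPrime 𝔫) ^ 2 →
              iotaFlatT (Localization.AtPrime 𝔫) (algebraMap (cobordantAlgebra' u w) (Localization.AtPrime 𝔫) g) <
                iotaFlatT S f) : KeyRungGrHomLE 3 p :=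
  keyRungGrHomLE_three_of_tieDescent_point_nonreachK p hD hPOINT (nonreachK_holds p)

/-- **NEW GAP LIST OF RECORD, (c11)-form — (c11)≤3 + (D-b³-point).** [OURS · L1 W4.3 · audit glue] -/
theorem keyRungGrHomLE_three_of_c11_point (p : ℕ) (hc11 : IotaJEssSmoothCompatibleLE 3 iotaFlatT jFlatT)
    (hPOINT : ∀ (k₀ : Type) [Field k₀] [CharP k₀ p] [PerfectField k₀]
      (S : Type) [CommRing S] [Algebra k₀ S] [Algebra.EssFiniteType k₀ S] [IsRegularLocalRing S]
      (f : S), ringKrullDim S = 3 → f ≠ 0 → f ∈ (maximalIdeal S) ^ 2 →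
      ∀ (P : Ideal S) [P.IsPrime], IsRegularLocalRing (S ⧸ P) → f ∈ P →
        topStratum iotaOrdEpsTau S f = {𝔮 | P ≤ 𝔮.asIdeal} → ¬ ringKrullDim (Localization.AtPrime P) ≤ 1 →
        P = maximalIdeal S →
        ∀ (n : ℕ) (u : Fin n → S) (w : Fin n → ℕ),
          Ideal.span (Set.range u) = maximalIdeal S → (maximalIdeal S).spanFinrank = n → (∃ i, 0 < w i) →
          Ideal.span {x | ∃ i, 0 < w i ∧ x = u i} = P →
          (∀ m : ℕ, weightedMonomialIdeal u w m = jFlatT S f m) →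
          ∀ (𝔫 : Ideal (cobordantAlgebra' u w)) [𝔫.IsPrime], IsTHomogeneous u w 𝔫 → cobordantT' u w ∈ 𝔫 →
            (maximalIdeal S).map (algebraMap S (cobordantAlgebra' u w)) ≤ 𝔫 →
            ¬ extReesAlgebra.vertexIdeal (weightedMonomialIdeal u w) ≤ 𝔫 →
            ∀ (a : ℕ) (g : cobordantAlgebra' u w), algebraMap S (cobordantAlgebra' u w) f = cobordantT' u w ^ a * g →
              ¬ cobordantT' u w ∣ g →
              algebraMap (cobordantAlgebra' u w) (Localization.AtPrime 𝔫) g ∈ maximalIdeal (Localization.AtPrime 𝔫) ^ 2 →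
              iotaFlatT (Localization.AtPrime 𝔫) (algebraMap (cobordantAlgebra' u w) (Localization.AtPrime 𝔫) g) <
                iotaFlatT S f) : KeyRungGrHomLE 3 p :=
  keyRungGrHomLE_three_of_c11_point_nonreachK p hc11 hPOINT (nonreachK_holds p)

end Iota3

end Summit.ResolutionOfSingularities.ResolutionOfSingularities.Cruxes.HypersurfaceCentreConstruction.LocalEngine

end
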